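import Summits.NavierStokesRegularity.FunctionalMining.VorticityL4Pointwise

/-!
# FunctionalMining — K0 row `E.q=4|T_LD|G1`, step 2: Calderón–Zygmund at the exponent `8`

Search for candidate a priori estimates; no regularity claim.

The tree's Bochner-form Calderón–Zygmund bound `Torus.exists_gradLs_le_vorticityLs`
(`(∫|∇v|^s)^{1/s} ≤ K_s (∫|ω|^s)^{1/s}`, `1 < s`, Majda–Bertozzi 2002 (11.9)) at `s = 8`, read
with natural-number powers: there is `K ≥ 0` with
`∫ (∑ₖ‖∂ₖv‖²)⁴ ≤ K ∫ ‖curl v‖⁸` for every smooth divergence-free `v` on `T³`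
(`exists_integral_gradSq_pow_four_le`). This is the only non-elementary input of the `Z₄` chain
besides the mean-zero Sobolev inequality.
-/

noncomputable section

open MeasureTheory Finset Set
open scoped InnerProductSpace RealInnerProductSpace ContDiff

namespace Summit.NavierStokesRegularity.FunctionalMining

open Literature.Analysis.FunctionSpaces Literature.Analysis.FunctionSpaces.Torus
  Literature.Analysis.FluidPDE

namespace VorticityL4

/-- `(√a)^(8 : ℝ) = a⁴` for `a ≥ 0`. [folklore] -/
theorem sqrt_rpow_eight {a : ℝ} (ha : 0 ≤ a) : Real.sqrt a ^ (8 : ℝ) = a ^ 4 := by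
  rw [show (8 : ℝ) = ((8 : ℕ) : ℝ) by norm_num, Real.rpow_natCast]
  have h2 : Real.sqrt a ^ 2 = a := Real.sq_sqrt ha
  calc Real.sqrt a ^ 8 = (Real.sqrt a ^ 2) ^ 4 := by ring
    _ = a ^ 4 := by rw [h2]

/-- From `a^{1/8} ≤ K b^{1/8}` with `a, b ≥ 0` to `a ≤ K⁸ b`. [folklore] -/
theorem le_of_rpow_inv_eight_le {a b K : ℝ} (ha : 0 ≤ a) (hb : 0 ≤ b)
    (h : a ^ (1 / (8 : ℝ)) ≤ K * b ^ (1 / (8 : ℝ))) : a ≤ K ^ 8 * b := by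
  have h8 := pow_le_pow_left₀ (Real.rpow_nonneg ha _) h 8
  have ea : (a ^ (1 / (8 : ℝ))) ^ 8 = a := by
    rw [← Real.rpow_natCast, ← Real.rpow_mul ha]; norm_num
  have eb : (b ^ (1 / (8 : ℝ))) ^ 8 = b := by
    rw [← Real.rpow_natCast, ← Real.rpow_mul hb]; norm_num
  rw [ea, mul_pow, eb] at h8
  exact h8

/-- **Calderón–Zygmund at `s = 8`, natural powers.** There is `K ≥ 0` such that for every smooth
divergence-free `v : T³ → ℝ³`, `∫ (∑ₖ‖∂ₖv‖²)⁴ ≤ K ∫ ‖curl v‖⁸` — the tree's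
`Torus.exists_gradLs_le_vorticityLs` at `s = 8` (`(√g)⁸ = g⁴`, `√|ω|² ^ 8 = ‖curl v‖⁸`), raised
to the eighth power. [cite: MajdaBertozziCUP2002, §11.1 eq. (11.9) with Prop. 10.6] -/
theorem exists_integral_gradSq_pow_four_le :
    ∃ K : ℝ, 0 ≤ K ∧ ∀ v : UnitAddTorus (Fin 3) → EuclideanSpace ℝ (Fin 3), IsSmooth v →
      IsDivFree v →
      ∫ x, (∑ k, ‖partialDeriv k v x‖ ^ 2) ^ 4 ≤ K * ∫ x, ‖BDSV.curl v x‖ ^ 8 := by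
  obtain ⟨K, hK0, hK⟩ := Torus.exists_gradLs_le_vorticityLs (s := 8) (by norm_num)
  refine ⟨K ^ 8, by positivity, fun v hv hdiv => ?_⟩
  have h := hK v hv hdiv
  have e1 : ∫ x, Real.sqrt (∑ j, ‖partialDeriv j v x‖ ^ 2) ^ (8 : ℝ) =
      ∫ x, (∑ k, ‖partialDeriv k v x‖ ^ 2) ^ 4 :=
    integral_congr_ae (ae_of_all _ fun x => by
      show Real.sqrt (∑ j, ‖partialDeriv j v x‖ ^ 2) ^ (8 : ℝ) = (∑ k, ‖partialDeriv k v x‖ ^ 2) ^ 4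
      exact sqrt_rpow_eight (Finset.sum_nonneg fun k _ => sq_nonneg _))
  have e2 : ∫ x, Real.sqrt (torusVorticitySqAt v x) ^ (8 : ℝ) = ∫ x, ‖BDSV.curl v x‖ ^ 8 :=
    integral_congr_ae (ae_of_all _ fun x => by
      show Real.sqrt (torusVorticitySqAt v x) ^ (8 : ℝ) = ‖BDSV.curl v x‖ ^ 8
      rw [sqrt_rpow_eight (torusVorticitySqAt_nonneg v x), ← norm_curl_sq]; ring)
  rw [e1, e2] at h
  exact le_of_rpow_inv_eight_le (integral_nonneg fun x => by positivity)
    (integral_nonneg fun x => by positivity) h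

end VorticityL4

end Summit.NavierStokesRegularity.FunctionalMining
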